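import Mathlib
import Literature.Barriers.CriticalPhenomena.EmbeddingModulusUniqueness
import Literature.Probability.Percolation.QuadCrossingSquareModel
import Literature.Probability.RandomPlanarGeometry.RectangleModulusLambda
import Literature.Probability.RandomPlanarGeometry.ImageUnivalent
import Literature.Probability.RandomPlanarGeometry.CardyFunctionIncBeta
import Literature.Probability.RandomPlanarGeometry.ChordalCurveFamily
import HarnessLib

/-!
# The diamond shear chart: the modulus of Beffara's sheared diamond along the unit semicircle

Topic `Literature/Probability/RandomPlanarGeometry`.  Beffara's shear `φ_α(x + iy) = x + α y`
(`Literature.Barriers.CriticalPhenomena.moduliShear`, Beffara 2008 §1.1) pushes a conformal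
rectangle `(Ω; A, B, C, D)` to `(φ_α Ω; φ_α A, …)` (§2.1, proof of Prop. 4).  For the moduli on the
UNIT SEMICIRCLE `α = e^{iθ}`, `0 < θ < π` — parametrised rationally by `s = tan(θ/2) > 0`,
`α(s) = (1 + is)² / (1 + s²)` — there is ONE test quad whose sheared images have an explicitly
known conformal modulus: the tilted square ("diamond") `D = (1+i)·(0,1)²` with its corners
`0, 1+i, 2i, -1+i` marked.  Indeed `φ_{α(s)} D` is a genuine RECTANGLE (the sides `1 ± α` are
perpendicular when `|α| = 1`), similar to `(0,s) × (0,1)` with the Bollobás–Riordan corner marking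
`(i, 0, s, s+i)`, whose Cardy cross-ratio is `λ(is)` (`rectangle_crossRatio_eq_lamR`,
Kleban–Zagier 2003 §3).  Hence (all PROVED here, no definition is introduced):

* `circleParam_eq`, `circleParam_im_pos`, `norm_circleParam`, `exists_circleParam_of_norm_eq_one`,
  `analyticAt_circleParam` — the rational parametrisation `s ↦ (1 + is)²/(1 + s²)` of the upper unit
  semicircle (`re = (1-s²)/(1+s²)`, `im = 2s/(1+s²)`; every `α` with `‖α‖ = 1`, `0 < im α` is
  `α(s)` for a unique `s = im α / (1 + re α) > 0`; real-analytic as a map `ℝ → ℂ`);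
* `diamond_shear_crossRatio_eq_lamR` / `exists_diamond_shear_chart` — every uniformizing datum of
  every presentation `R` of `φ_{α(s)} D` (`R.carrier = φ_{α(s)} '' D.carrier`, `R.pt i = φ_{α(s)} (D.pt i)`)
  has `crossRatio x = λ(is) = KlebanZagier.lamR s`;
* `analyticAt_lamR`, `strictAntiOn_lamR` — `s ↦ λ(is)` is real-analytic and strictly decreasing
  on `(0, ∞)` (from the tree's `hasDerivAt_lamC`, `hasDerivAt_lamR`);
* `analyticAt_cardyFunction_lamR`, `hasDerivAt_cardyFunction_lamR`,
  `deriv_cardyFunction_lamR_neg`, `strictAntiOn_cardyFunction_lamR` — the CHART FUNCTION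
  `s ↦ F(λ(is))` (Cardy's value of the sheared diamond) is real-analytic with negative derivative,
  hence a strictly decreasing analytic diffeomorphism onto its image: the modulus `α(s)` of a good
  point is an analytic function of ONE limiting crossing probability.

These are the chart lemmas of the accumulation step of the openness argument for the set of
self-dual parameters with a Cardy scaling limit (corner percolation, Beffara's embedding question).

## References

* V. Beffara, *Is critical 2D percolation universal?*, Progr. Probab. 60 (2008) 31–58, §1.1 and
  §2.1 Prop. 4. [Beffara2008Universal]
* P. Kleban, D. Zagier, *Crossing probabilities and modular forms*, J. Stat. Phys. 113 (2003),
  §3. [KlebanZagier2003]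
* B. Bollobás, O. Riordan, *Percolation*, CUP (2006), Ch. 7 §7.1. [BollobasRiordan2006]
-/

noncomputable section

open Set Filter Complex
open scoped Topology Real
open UpperHalfPlane (upperHalfPlaneSet)

namespace Literature.Probability.RandomPlanarGeometry

open KlebanZagier Literature.Barriers.CriticalPhenomena Literature.Probability.Percolation
open Literature.NumberTheory.EllipticCurves.JacobiThetaNull

/-! ### The rational parametrisation of the upper unit semicircle -/

/-- `(1 + is)²/(1 + s²) = (1 - s²)/(1 + s²) + i · 2s/(1 + s²)` (the half-angle substitution
`s = tan(θ/2)`, `cos θ = (1-s²)/(1+s²)`, `sin θ = 2s/(1+s²)`). [folklore] -/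
theorem circleParam_eq (s : ℝ) :
    (1 + (s : ℂ) * I) ^ 2 / (1 + (s : ℂ) ^ 2) =
      ⟨(1 - s ^ 2) / (1 + s ^ 2), 2 * s / (1 + s ^ 2)⟩ := by
  have h : (1 : ℂ) + (s : ℂ) ^ 2 = ((1 + s ^ 2 : ℝ) : ℂ) := by push_cast; ring
  have hsq : (1 + (s : ℂ) * I) ^ 2 = ⟨1 - s ^ 2, 2 * s⟩ := by
    apply Complex.ext
    · simp [sq]
    · simp [sq]; ring
  rw [h, hsq]
  apply Complex.ext
  · rw [Complex.div_ofReal_re]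
  · rw [Complex.div_ofReal_im]

/-- The parametrised point lies in the upper half-plane for `s > 0`. [folklore] -/
theorem circleParam_im_pos {s : ℝ} (hs : 0 < s) :
    0 < ((1 + (s : ℂ) * I) ^ 2 / (1 + (s : ℂ) ^ 2)).im := by
  rw [circleParam_eq]
  positivity

/-- The parametrised point lies on the unit circle. [folklore] -/
theorem normSq_circleParam (s : ℝ) :
    Complex.normSq ((1 + (s : ℂ) * I) ^ 2 / (1 + (s : ℂ) ^ 2)) = 1 := by
  rw [circleParam_eq, Complex.normSq_mk]
  have hs2 : (1 : ℝ) + s ^ 2 ≠ 0 := by positivity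
  field_simp
  ring

/-- The parametrised point has norm one. [folklore] -/
theorem norm_circleParam (s : ℝ) : ‖(1 + (s : ℂ) * I) ^ 2 / (1 + (s : ℂ) ^ 2)‖ = 1 := by
  have h := normSq_circleParam s
  rw [Complex.normSq_eq_norm_sq] at h
  nlinarith [norm_nonneg ((1 + (s : ℂ) * I) ^ 2 / (1 + (s : ℂ) ^ 2))]

/-- **Every point of the upper unit semicircle is `(1 + is)²/(1 + s²)` for some `s > 0`**
(`s = im α / (1 + re α) = tan(θ/2)` for `α = e^{iθ}`). [folklore] -/
theorem exists_circleParam_of_norm_eq_one {α : ℂ} (hα : ‖α‖ = 1) (him : 0 < α.im) :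
    ∃ s : ℝ, 0 < s ∧ α = (1 + (s : ℂ) * I) ^ 2 / (1 + (s : ℂ) ^ 2) := by
  have hn : α.re * α.re + α.im * α.im = 1 := by
    rw [← Complex.normSq_apply, Complex.normSq_eq_norm_sq, hα, one_pow]
  have hre : -1 < α.re := by
    by_contra h
    have h1 : α.re ≤ -1 := not_lt.1 h
    have h2 : -1 ≤ α.re := by
      have := abs_re_le_norm α
      rw [hα] at this
      exact (abs_le.1 this).1
    have h3 : α.re = -1 := le_antisymm h1 h2
    rw [h3] at hn
    nlinarith
  have h1 : (0 : ℝ) < 1 + α.re := by linarith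
  refine ⟨α.im / (1 + α.re), div_pos him h1, ?_⟩
  rw [circleParam_eq]
  apply Complex.ext
  · simp only
    rw [eq_div_iff (by positivity)]
    field_simp
    nlinarith [hn]
  · simp only
    rw [eq_div_iff (by positivity)]
    field_simp
    nlinarith [hn]

/-- The unit-semicircle parameter is unique: `(1 + is)²/(1 + s²)` is injective in `s > 0`
(indeed `s = im/(1 + re)`). [folklore] -/
theorem circleParam_injective {s s' : ℝ}
    (h : (1 + (s : ℂ) * I) ^ 2 / (1 + (s : ℂ) ^ 2) = (1 + (s' : ℂ) * I) ^ 2 / (1 + (s' : ℂ) ^ 2)) :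
    s = s' := by
  rw [circleParam_eq, circleParam_eq] at h
  have hre := congrArg Complex.re h
  have him := congrArg Complex.im h
  simp only at hre him
  have hs2 : (1 : ℝ) + s ^ 2 ≠ 0 := by positivity
  have hs2' : (1 : ℝ) + s' ^ 2 ≠ 0 := by positivity
  rw [div_eq_div_iff hs2 hs2'] at hre him
  nlinarith [hre, him, sq_nonneg (s - s'), sq_nonneg (s + s')]

/-- The parametrisation `s ↦ (1 + is)²/(1 + s²)` is real-analytic `ℝ → ℂ`. [folklore] -/
theorem analyticAt_circleParam (s : ℝ) :
    AnalyticAt ℝ (fun s : ℝ => (1 + (s : ℂ) * I) ^ 2 / (1 + (s : ℂ) ^ 2)) s := by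
  have h : AnalyticAt ℝ (fun s : ℝ => (s : ℂ)) s := Complex.ofRealCLM.analyticAt s
  have hne : (1 : ℂ) + (s : ℂ) ^ 2 ≠ 0 := by
    have : (1 : ℂ) + (s : ℂ) ^ 2 = ((1 + s ^ 2 : ℝ) : ℂ) := by push_cast; ring
    rw [this, Ne, Complex.ofReal_eq_zero]
    positivity
  exact ((analyticAt_const.add (h.mul analyticAt_const)).pow 2).div
    (analyticAt_const.add (h.pow 2)) hne

/-! ### `λ(is)` is real-analytic and strictly decreasing in `s > 0` -/

/-- **`s ↦ λ(is)` is real-analytic on `(0, ∞)`**: `λ = θ₂⁴/θ₃⁴` is holomorphic on `ℍ`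
(`hasDerivAt_lamC`) and `λ(is)` is its real part along the analytic path `s ↦ is`.
[cite: KlebanZagier2003, §3] -/
theorem analyticAt_lamR {s : ℝ} (hs : 0 < s) : AnalyticAt ℝ lamR s := by
  have hC : AnalyticAt ℂ lamC (I * s) := by
    refine DifferentiableOn.analyticAt (s := {τ : ℂ | 0 < τ.im}) (fun τ hτ => ?_) ?_
    · exact (hasDerivAt_lamC hτ).differentiableAt.differentiableWithinAt
    · exact (isOpen_lt continuous_const Complex.continuous_im).mem_nhds (by simp [hs])
  have hpath : AnalyticAt ℝ (fun t : ℝ => (I * t : ℂ)) s :=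
    analyticAt_const.mul (Complex.ofRealCLM.analyticAt s)
  have hcomp : AnalyticAt ℝ (fun t : ℝ => (lamC (I * t)).re) s :=
    (Complex.reCLM.analyticAt _).comp_of_eq
      (AnalyticAt.comp_of_eq (hC.restrictScalars (𝕜 := ℝ)) hpath rfl) rfl
  refine hcomp.congr ?_
  filter_upwards [isOpen_Ioi.mem_nhds hs] with t ht
  rw [lamC_I_mul ht, Complex.ofReal_re]

/-- **`s ↦ λ(is)` is strictly decreasing on `(0, ∞)`** (`(d/ds) λ(is) = -π λ θ₄⁴ < 0`,
`hasDerivAt_lamR`). [cite: KlebanZagier2003, §3] -/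
theorem strictAntiOn_lamR : StrictAntiOn lamR (Ioi 0) := by
  refine strictAntiOn_of_deriv_neg (convex_Ioi 0)
    (fun t ht => (hasDerivAt_lamR ht).continuousAt.continuousWithinAt) fun t ht => ?_
  rw [interior_Ioi] at ht
  rw [(hasDerivAt_lamR ht).deriv]
  have h1 := (lamR_mem_Ioo ht).1
  have h2 := theta4_I_mul_re_pos ht
  have : 0 < π * lamR t * (theta4 (I * t)).re ^ 4 := by positivity
  linarith

/-! ### The chart function `s ↦ F(λ(is))` -/

/-- The chart function `s ↦ F(λ(is))` (Cardy's value at the modulus `λ(is)`) is real-analytic on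
`(0, ∞)`. [folklore] -/
theorem analyticAt_cardyFunction_lamR {s : ℝ} (hs : 0 < s) :
    AnalyticAt ℝ (fun s => cardyFunction (lamR s)) s :=
  (analyticOnNhd_cardyFunction_Ioo _ (lamR_mem_Ioo hs)).comp (analyticAt_lamR hs)

/-- The derivative of the chart function: `F'(λ(is)) · (d/ds)λ(is)` (chain rule with Cardy's
`F' = (cardyConst/3)(η(1-η))^{-2/3}` and `(d/ds)λ(is) = -πλθ₄⁴`). [folklore] -/
theorem hasDerivAt_cardyFunction_lamR {s : ℝ} (hs : 0 < s) :
    HasDerivAt (fun s => cardyFunction (lamR s))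
      (cardyConst / 3 * (lamR s * (1 - lamR s)) ^ (-(2 / 3 : ℝ)) *
        -(π * lamR s * (theta4 (I * s)).re ^ 4)) s :=
  (hasDerivAt_cardyFunction_holds (lamR_mem_Ioo hs)).comp s (hasDerivAt_lamR hs)

/-- **The chart function has negative derivative** on `(0, ∞)` (`F' > 0`, `(d/ds)λ(is) < 0`).
[folklore] -/
theorem deriv_cardyFunction_lamR_neg {s : ℝ} (hs : 0 < s) :
    deriv (fun s => cardyFunction (lamR s)) s < 0 := by
  rw [(hasDerivAt_cardyFunction_lamR hs).deriv]
  have hl := lamR_mem_Ioo hs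
  have h1 : 0 < cardyConst / 3 * (lamR s * (1 - lamR s)) ^ (-(2 / 3 : ℝ)) := by
    have : 0 < lamR s * (1 - lamR s) := mul_pos hl.1 (by linarith [hl.2])
    have := cardyConst_pos
    positivity
  have h2 : 0 < π * lamR s * (theta4 (I * s)).re ^ 4 := by
    have := hl.1
    have := theta4_I_mul_re_pos hs
    positivity
  exact mul_neg_of_pos_of_neg h1 (neg_lt_zero.2 h2)

/-- The chart function has non-vanishing derivative on `(0, ∞)`. [folklore] -/
theorem deriv_cardyFunction_lamR_ne_zero {s : ℝ} (hs : 0 < s) :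
    deriv (fun s => cardyFunction (lamR s)) s ≠ 0 :=
  (deriv_cardyFunction_lamR_neg hs).ne

/-- **The chart function is strictly decreasing on `(0, ∞)`** (`λ(is)` decreases in `(0,1)` and
`F` increases on `[0,1]`). [folklore] -/
theorem strictAntiOn_cardyFunction_lamR :
    StrictAntiOn (fun s => cardyFunction (lamR s)) (Ioi 0) := by
  intro a ha b hb hab
  have hla := lamR_mem_Ioo ha
  have hlb := lamR_mem_Ioo hb
  exact strictMonoOn_cardyFunction_holds ⟨hlb.1.le, hlb.2.le⟩ ⟨hla.1.le, hla.2.le⟩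
    (strictAntiOn_lamR ha hb hab)

/-- The chart function takes values in `(0, 1)`. [folklore] -/
theorem cardyFunction_lamR_mem_Ioo {s : ℝ} (hs : 0 < s) :
    cardyFunction (lamR s) ∈ Ioo (0 : ℝ) 1 := by
  have hl := lamR_mem_Ioo hs
  have hmono : StrictMonoOn cardyFunction (Icc 0 1) := strictMonoOn_cardyFunction_holds
  have hF1 : cardyFunction 1 = 1 := cardyFunction_one_holds
  have hl' : lamR s ∈ Icc (0 : ℝ) 1 := ⟨hl.1.le, hl.2.le⟩
  constructor
  · have h := hmono (left_mem_Icc.2 zero_le_one) hl' hl.1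
    rwa [cardyFunction_zero] at h
  · have h := hmono hl' (right_mem_Icc.2 zero_le_one) hl.2
    rwa [hF1] at h

/-! ### The diamond test quad -/

/-- **The diamond shear chart.** Let `D` be the tilted square `(1+i)·(0,1)²` with its corners
`0, 1+i, 2i, -1+i` marked (any marked Jordan domain with this carrier and these marked points), and
`α = (1 + is)²/(1 + s²)`, `s > 0`, a point of the upper unit semicircle.  Then every uniformizing
datum `(φ, x)` of every presentation `R` of the sheared diamond `φ_α D` has Cardy cross-ratio
`λ(is)`: the similarity `h(z) = i - (s + i) z / 2` maps `φ_α D` onto the rectangle `(0,s) × (0,1)`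
with the corner marking `(i, 0, s, s + i)` of `rectangle_crossRatio_eq_lamR` (pointwise
`h (φ_α ((1+i) u)) = s · im u + i (1 - re u)`; the sides `1 ± α` of `φ_α D` are perpendicular since
`|α| = 1`), and the cross-ratio is a conformal invariant
(`ConformalRectangle.crossRatio_eq_of_image_data`). [cite: Beffara2008Universal, §2.1 Proposition 4 (proof)] -/
theorem diamond_shear_crossRatio_eq_lamR {D : ConformalRectangle}
    (hDc : D.carrier = (fun z => (1 + I) * z) '' (Ioo (0 : ℝ) 1 ×ℂ Ioo (0 : ℝ) 1))
    (hDp : D.pt 0 = 0 ∧ D.pt 1 = 1 + I ∧ D.pt 2 = 2 * I ∧ D.pt 3 = -1 + I)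
    {s : ℝ} (hs : 0 < s) (R : ConformalRectangle)
    (φ : ConformalEquiv upperHalfPlaneSet R.carrier) (x : Fin 4 → ℝ)
    (hc : R.carrier = moduliShear ((1 + (s : ℂ) * I) ^ 2 / (1 + (s : ℂ) ^ 2)) '' D.carrier)
    (hp : ∀ i, R.pt i = moduliShear ((1 + (s : ℂ) * I) ^ 2 / (1 + (s : ℂ) ^ 2)) (D.pt i))
    (hu : R.IsUniformizing φ x) : crossRatio x = lamR s := by
  set α : ℂ := (1 + (s : ℂ) * I) ^ 2 / (1 + (s : ℂ) ^ 2) with hαdef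
  have hα : α = ⟨(1 - s ^ 2) / (1 + s ^ 2), 2 * s / (1 + s ^ 2)⟩ := circleParam_eq s
  -- the similarity `h z = i - (s + i) z / 2`
  set h : ℂ → ℂ := fun z => I - ((s : ℂ) + I) / 2 * z with hh
  have hcont : Continuous h := by
    rw [hh]
    fun_prop
  have hsI : (s : ℂ) + I ≠ 0 := by
    intro e
    have := congrArg Complex.im e
    simp at this
  have hinj : Function.Injective h := by
    intro z w hzw
    have e : ((s : ℂ) + I) / 2 * z = ((s : ℂ) + I) / 2 * w := by
      have := congrArg (fun v => I - v) hzw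
      simpa [hh] using this
    exact mul_left_cancel₀ (div_ne_zero hsI two_ne_zero) e
  have hdiff : Differentiable ℂ h := by
    rw [hh]
    fun_prop
  -- the pointwise chart
  have key : ∀ u : ℂ, h (moduliShear α ((1 + I) * u)) = ⟨s * u.im, 1 - u.re⟩ := by
    intro u
    have hs2 : (1 : ℝ) + s ^ 2 ≠ 0 := by positivity
    apply Complex.ext
    · simp [hh, moduliShear, hα]
      field_simp
      ring
    · simp [hh, moduliShear, hα]
      field_simp
      ring
  obtain ⟨S, hSc, hSp⟩ := R.exists_image h hcont.continuousOn hinj.injOn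
  have hSc' : S.carrier = (Ioo (0 : ℝ) s ×ℂ Ioo (0 : ℝ) 1) := by
    rw [hSc, hc, hDc, image_image, image_image]
    ext z
    simp only [mem_image, key, Complex.mem_reProdIm, mem_Ioo]
    constructor
    · rintro ⟨u, ⟨⟨h1, h2⟩, h3, h4⟩, rfl⟩
      refine ⟨⟨?_, ?_⟩, ?_, ?_⟩ <;> dsimp only <;> nlinarith
    · rintro ⟨⟨h1, h2⟩, h3, h4⟩
      refine ⟨⟨1 - z.im, z.re / s⟩, ⟨⟨?_, ?_⟩, ?_, ?_⟩, ?_⟩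
      · dsimp only; linarith
      · dsimp only; linarith
      · dsimp only; positivity
      · dsimp only; rw [div_lt_one hs]; exact h2
      · apply Complex.ext
        · dsimp only; field_simp
        · dsimp only; ring
  have hSp' : S.pt 0 = ((1 : ℝ) : ℂ) * Complex.I ∧ S.pt 1 = 0 ∧ S.pt 2 = (s : ℂ) ∧
      S.pt 3 = (s : ℂ) + ((1 : ℝ) : ℂ) * Complex.I := by
    obtain ⟨p0, p1, p2, p3⟩ := hDp
    refine ⟨?_, ?_, ?_, ?_⟩
    · rw [hSp, hp, p0, ← mul_zero (1 + I), key]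
      apply Complex.ext <;> simp
    · rw [hSp, hp, p1, ← mul_one (1 + I), key]
      apply Complex.ext <;> simp
    · rw [hSp, hp, p2, show (2 : ℂ) * I = (1 + I) * (1 + I) by ring_nf; rw [Complex.I_sq]; ring,
        key]
      apply Complex.ext <;> norm_num
    · rw [hSp, hp, p3, show (-1 : ℂ) + I = (1 + I) * I by ring_nf; rw [Complex.I_sq]; ring, key]
      apply Complex.ext <;> simp
  obtain ⟨ψ, y, hψ⟩ := MarkedDomain.exists_isUniformizing_holds S
  have h1 := rectangle_crossRatio_eq_lamR S hs one_pos hSc' hSp' ψ y hψ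
  rw [div_one] at h1
  rw [← h1]
  exact ConformalRectangle.crossRatio_eq_of_image_data hdiff.differentiableOn hinj.injOn
    hcont.continuousOn hSc hSp hu hψ

/-- **The diamond test quad exists** (the shape used by the openness argument): there is ONE
conformal rectangle `D` — the tilted model square `(rectQuad 0 1 0 1).map (z ↦ (1+i) z)`, whose
marked points are the corners `0, 1+i, 2i, -1+i` (read off the side descriptions
`mem_rectQuad_arc_*` of the tree) — such that for every `s > 0` every uniformizing datum of every
presentation of `φ_{(1+is)²/(1+s²)} D` has Cardy cross-ratio `λ(is)`.
[cite: Beffara2008Universal, §2.1 Proposition 4 (proof)] -/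
theorem exists_diamond_shear_chart :
    ∃ D : ConformalRectangle, ∀ s : ℝ, 0 < s → ∀ (R : ConformalRectangle)
      (φ : ConformalEquiv upperHalfPlaneSet R.carrier) (x : Fin 4 → ℝ),
      R.carrier = moduliShear ((1 + (s : ℂ) * I) ^ 2 / (1 + (s : ℂ) ^ 2)) '' D.carrier →
      (∀ i, R.pt i = moduliShear ((1 + (s : ℂ) * I) ^ 2 / (1 + (s : ℂ) ^ 2)) (D.pt i)) →
      R.IsUniformizing φ x → crossRatio x = lamR s := by
  have h11 : (1 : ℂ) + I ≠ 0 := by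
    intro h
    have := congrArg Complex.re h
    simp at this
  set Q := rectQuad 0 1 0 1 one_pos one_pos with hQ
  -- the corners of the model square (adapted from `RectilinearCardy.Negative.rectQuad_pt`)
  have a0 : Q.pt 0 ∈ Q.arc 0 := Q.pt_mem_arc_self 0
  have a1 : Q.pt 1 ∈ Q.arc 1 := Q.pt_mem_arc_self 1
  have a2 : Q.pt 2 ∈ Q.arc 2 := Q.pt_mem_arc_self 2
  have a3 : Q.pt 3 ∈ Q.arc 3 := Q.pt_mem_arc_self 3
  have b3 : Q.pt 0 ∈ Q.arc 3 := by simpa using Q.pt_succ_mem_arc 3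
  have b0 : Q.pt 1 ∈ Q.arc 0 := by simpa using Q.pt_succ_mem_arc 0
  have b1 : Q.pt 2 ∈ Q.arc 1 := by simpa using Q.pt_succ_mem_arc 1
  have b2 : Q.pt 3 ∈ Q.arc 2 := by simpa using Q.pt_succ_mem_arc 2
  rw [mem_rectQuad_arc_zero] at a0 b0
  rw [mem_rectQuad_arc_one] at a1 b1
  rw [mem_rectQuad_arc_two] at a2 b2
  rw [mem_rectQuad_arc_three] at a3 b3
  have p0 : Q.pt 0 = 0 := by
    apply Complex.ext <;> simp [a0.1, b3.1]
  have p1 : Q.pt 1 = 1 := by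
    apply Complex.ext <;> simp [a1.1, b0.1]
  have p2 : Q.pt 2 = 1 + I := by
    apply Complex.ext <;> simp [a2.1, b1.1]
  have p3 : Q.pt 3 = I := by
    apply Complex.ext <;> simp [a3.1, b2.1]
  refine ⟨Q.map (Homeomorph.mulLeft₀ (1 + I) h11), fun s hs R φ x hc hp hu =>
    diamond_shear_crossRatio_eq_lamR ?_ ?_ hs R φ x hc hp hu⟩
  · rw [MarkedDomain.carrier_map, Homeomorph.coe_mulLeft₀, hQ, rectQuad_carrier]
  · simp only [MarkedDomain.pt_map, Homeomorph.coe_mulLeft₀, p0, p1, p2, p3]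
    refine ⟨by ring, by ring, ?_, ?_⟩
    · ring_nf
      rw [Complex.I_sq]
      ring
    · ring_nf
      rw [Complex.I_sq]
      ring

end Literature.Probability.RandomPlanarGeometry

end
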